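import Summits.CriticalPhenomena.CardyFormulaZ2.Theorems.CardyBoundaryCoulombGasBoundaryDefectGaussianRStubTransportPathsPart10

/-!
# Stub `stub_transportPaths` of line `rainbow-monomials-in-excursion-kernels` — Part 14:
# one mover (route execution with the other points parked)
# (crux `CardyBoundaryCoulombGas.BoundaryDefectGaussianR`, stmt-CriticalPhenomena-14132)

(T5, combinatorial core.) `tp_one_mover`: in a configuration `P : Fin k → ℤ²` with admissible
rainbow datum, move the point `i` along a route `pos 0 = P i, pos 1, …, pos Lr` whose steps are
either UNIT SLIDES along a flat rail (the side conditions of `s3_admissible_slide`) or JUMPS whose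
landing dart is linked to the take-off dart by the boundary walk (the side conditions of
`tp_admissible_jump`, Part 10), all positions being flat and separated from the parked points
(abstract predicates `Fl`, `FlR`, `Sep`, `JumpOK`; `Sep` forces `ℓ∞`-distance `≥ G ≥ Σ legs`).
Then admissibility propagates along the route and the route is a transport path in the sense of
TRANSPORT (`Good` = injective + admissible + flat + separated at every time, `Step` = unit slide
or certified jump), with `Lr` steps and as many jumps as jump steps. All [folklore].
-/

noncomputable section

namespace Summit.CriticalPhenomena.CardyFormulaZ2.Cruxes.BoundaryDefectGaussianR.RainbowMonomialsInExcursionKernels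

open Literature.Probability.LatticeModels Literature.Probability.LatticeModels.CollarLegModel

/-- The unit slides of TRANSPORT are the `±dir (kk+1)`. [folklore] -/
theorem tp_unit_of_dir (kk : Fin 4) (τ : ℤ × ℤ) (hτ : τ = dir (kk + 1) ∨ τ = -dir (kk + 1)) :
    τ = (1, 0) ∨ τ = (-1, 0) ∨ τ = (0, 1) ∨ τ = (0, -1) := by
  have h : ∀ kk : Fin 4, (dir (kk + 1) = (1, 0) ∨ dir (kk + 1) = (-1, 0) ∨ dir (kk + 1) = (0, 1) ∨
      dir (kk + 1) = (0, -1)) ∧ (-dir (kk + 1) = (1, 0) ∨ -dir (kk + 1) = (-1, 0) ∨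
      -dir (kk + 1) = (0, 1) ∨ -dir (kk + 1) = (0, -1)) := by decide
  rcases hτ with rfl | rfl
  · exact (h kk).1
  · exact (h kk).2

/-- From Euclidean separation `Sep` forcing `ℓ∞`-distance `≥ G`, the separation hypothesis of
`s3_admissible_slide` / `tp_admissible_jump` for a configuration. [folklore] -/
theorem tp_sep_config {k : ℕ} {G : ℕ} {Sep : ℤ × ℤ → ℤ × ℤ → Prop}
    (hSepG : ∀ u v, Sep u v → (G : ℤ) ≤ max |u.1 - v.1| |u.2 - v.2|) {Q : Fin k → ℤ × ℤ}
    (hQ : ∀ i₁ i₂ : Fin k, i₁ ≠ i₂ → Sep (Q i₁) (Q i₂)) :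
    ∀ a b : Fin k, a ≠ b → (G : ℤ) ≤ max |(Q a).1 - (Q b).1| |(Q a).2 - (Q b).2| :=
  fun a b hab => hSepG _ _ (hQ a b hab)

/-- **One mover.** See the module docstring. [folklore] -/
theorem tp_one_mover (k : ℕ) (L : Fin k → ℕ) (j : Fin k) (V : Finset (ℤ × ℤ)) (G : ℕ)
    (Fl FlR : ℤ × ℤ → Prop) (Sep JumpOK : ℤ × ℤ → ℤ × ℤ → Prop)
    (hG : ∑ b ∈ Finset.univ.erase j, L b ≤ G)
    (hSepG : ∀ u v, Sep u v → (G : ℤ) ≤ max |u.1 - v.1| |u.2 - v.2|)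
    (hSepne : ∀ u v, Sep u v → u ≠ v)
    (P : Fin k → ℤ × ℤ) (i : Fin k) (pos : ℕ → ℤ × ℤ) (Lr : ℕ) (σ : ℕ → Bool)
    (h0 : pos 0 = P i)
    (hFlP : ∀ i', i' ≠ i → Fl (P i'))
    (hSepP : ∀ i₁ i₂, i₁ ≠ i → i₂ ≠ i → i₁ ≠ i₂ → Sep (P i₁) (P i₂))
    (hFlpos : ∀ l, l ≤ Lr → Fl (pos l))
    (hSeppos : ∀ l, l ≤ Lr → ∀ i', i' ≠ i → Sep (pos l) (P i') ∧ Sep (P i') (pos l))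
    (hstep : ∀ l, l < Lr →
      (σ l = true → ∃ (kk : Fin 4) (τ : ℤ × ℤ), (τ = dir (kk + 1) ∨ τ = -dir (kk + 1)) ∧
        pos (l + 1) = pos l + τ ∧ pos l + dir kk ∉ V ∧ pos (l + 1) ∈ V ∧
        pos (l + 1) + dir kk ∉ V ∧ ((neighbours (pos (l + 1))).filter (fun z ↦ z ∉ V)).card = 1) ∧
      (σ l = false → (∀ i', i' ≠ i → FlR (P i')) ∧ JumpOK (pos l) (pos (l + 1)) ∧
        pos (l + 1) ∈ V ∧ ((neighbours (pos (l + 1))).filter (fun z ↦ z ∉ V)).card = 1 ∧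
        ∃ (dx dy : Dart) (g : ℕ), outDart V (pos l) = some dx ∧ outDart V (pos (l + 1)) = some dy ∧
          ((dsucc V)^[g] dx = dy ∨ (dsucc V)^[g] dy = dx)))
    (hadm : LegInsertionData.IsAdmissible
      (⟨(Finset.univ.erase j).image P, fun v ↦ ∑ b ∈ (Finset.univ.erase j).filter (fun b ↦ P b = v),
        L b, P j⟩ : LegInsertionData) V) :
    (∃ (q : ℕ → Fin k → ℤ × ℤ) (σ' : ℕ → Bool), q 0 = P ∧ q Lr = Function.update P i (pos Lr) ∧
      ((Finset.range Lr).filter (fun t => σ' t = false)).card ≤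
        ((Finset.range Lr).filter (fun t => σ t = false)).card ∧
      (∀ t, t ≤ Lr → (Function.Injective (q t) ∧
        LegInsertionData.IsAdmissible
          (⟨(Finset.univ.erase j).image (q t), fun v ↦ ∑ b ∈ (Finset.univ.erase j).filter
            (fun b ↦ (q t) b = v), L b, (q t) j⟩ : LegInsertionData) V ∧
        (∀ i, Fl (q t i)) ∧ (∀ i₁ i₂ : Fin k, i₁ ≠ i₂ → Sep (q t i₁) (q t i₂)))) ∧
      (∀ t, t < Lr →
        (σ' t = true → ∃ (i : Fin k) (τ : ℤ × ℤ), (τ = (1, 0) ∨ τ = (-1, 0) ∨ τ = (0, 1) ∨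
          τ = (0, -1)) ∧ q (t + 1) = Function.update (q t) i (q t i + τ)) ∧
        (σ' t = false → ∃ (i : Fin k) (q' : ℤ × ℤ), q (t + 1) = Function.update (q t) i q' ∧
          (∀ i', i' ≠ i → FlR (q t i')) ∧ JumpOK (q t i) q'))) ∧
    LegInsertionData.IsAdmissible
      (⟨(Finset.univ.erase j).image (Function.update P i (pos Lr)),
        fun v ↦ ∑ b ∈ (Finset.univ.erase j).filter (fun b ↦ Function.update P i (pos Lr) b = v),
        L b, Function.update P i (pos Lr) j⟩ : LegInsertionData) V := by
  -- the two predicates of TRANSPORT's conclusion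
  set Good : (Fin k → ℤ × ℤ) → Prop := fun Q => Function.Injective Q ∧
    LegInsertionData.IsAdmissible
      (⟨(Finset.univ.erase j).image Q, fun v ↦ ∑ b ∈ (Finset.univ.erase j).filter
        (fun b ↦ Q b = v), L b, Q j⟩ : LegInsertionData) V ∧
    (∀ i, Fl (Q i)) ∧ (∀ i₁ i₂ : Fin k, i₁ ≠ i₂ → Sep (Q i₁) (Q i₂)) with hGood
  set Step : (Fin k → ℤ × ℤ) → (Fin k → ℤ × ℤ) → Bool → Prop := fun Q Q' b =>
    (b = true → ∃ (i : Fin k) (τ : ℤ × ℤ), (τ = (1, 0) ∨ τ = (-1, 0) ∨ τ = (0, 1) ∨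
      τ = (0, -1)) ∧ Q' = Function.update Q i (Q i + τ)) ∧
    (b = false → ∃ (i : Fin k) (q' : ℤ × ℤ), Q' = Function.update Q i q' ∧
      (∀ i', i' ≠ i → FlR (Q i')) ∧ JumpOK (Q i) q') with hStep
  -- the configurations along the route
  set cfg : ℕ → Fin k → ℤ × ℤ := fun l => Function.update P i (pos l) with hcfg
  have hcfg_i : ∀ l, cfg l i = pos l := fun l => by simp [hcfg]
  have hcfg_o : ∀ l i', i' ≠ i → cfg l i' = P i' := fun l i' h => by simp [hcfg, h]
  have hcfg0 : cfg 0 = P := by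
    simp only [hcfg, h0]; exact Function.update_eq_self i P
  -- geometric goodness of every configuration of the route
  have hSepcfg : ∀ l, l ≤ Lr → ∀ i₁ i₂ : Fin k, i₁ ≠ i₂ → Sep (cfg l i₁) (cfg l i₂) := by
    intro l hl i₁ i₂ hne
    by_cases h1 : i₁ = i
    · subst h1
      rw [hcfg_i, hcfg_o l i₂ (Ne.symm hne)]
      exact (hSeppos l hl i₂ (Ne.symm hne)).1
    · by_cases h2 : i₂ = i
      · subst h2
        rw [hcfg_i, hcfg_o l i₁ h1]
        exact (hSeppos l hl i₁ h1).2
      · rw [hcfg_o l i₁ h1, hcfg_o l i₂ h2]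
        exact hSepP i₁ i₂ h1 h2 hne
  have hInjcfg : ∀ l, l ≤ Lr → Function.Injective (cfg l) := by
    intro l hl i₁ i₂ h
    by_contra hne
    exact hSepne _ _ (hSepcfg l hl i₁ i₂ hne) h
  have hFlcfg : ∀ l, l ≤ Lr → ∀ i', Fl (cfg l i') := by
    intro l hl i'
    by_cases h : i' = i
    · subst h; rw [hcfg_i]; exact hFlpos l hl
    · rw [hcfg_o l i' h]; exact hFlP i' h
  -- induction along the route
  have key : ∀ l, l ≤ Lr →
      (∃ (q : ℕ → Fin k → ℤ × ℤ) (σ' : ℕ → Bool), q 0 = P ∧ q l = cfg l ∧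
        ((Finset.range l).filter (fun t => σ' t = false)).card ≤
          ((Finset.range l).filter (fun t => σ t = false)).card ∧
        (∀ t, t ≤ l → Good (q t)) ∧ (∀ t, t < l → Step (q t) (q (t + 1)) (σ' t))) ∧
      LegInsertionData.IsAdmissible
        (⟨(Finset.univ.erase j).image (cfg l), fun v ↦ ∑ b ∈ (Finset.univ.erase j).filter
          (fun b ↦ (cfg l) b = v), L b, (cfg l) j⟩ : LegInsertionData) V := by
    intro l
    induction l with
    | zero =>
      intro _
      rw [hcfg0]
      refine ⟨?_, hadm⟩
      have hgood : Good P :=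
        ⟨hcfg0 ▸ hInjcfg 0 (Nat.zero_le _), hadm, hcfg0 ▸ hFlcfg 0 (Nat.zero_le _),
          hcfg0 ▸ hSepcfg 0 (Nat.zero_le _)⟩
      obtain ⟨q, σ', h1, h2, -, h4, h5⟩ := tp_path_refl Good Step hgood
      exact ⟨q, σ', h1, h2, by simp, h4, h5⟩
    | succ l ih =>
      intro hl
      obtain ⟨hpath, hadml⟩ := ih (by omega)
      have hgood : Good (cfg l) :=
        ⟨hInjcfg l (by omega), hadml, hFlcfg l (by omega), hSepcfg l (by omega)⟩
      have hupd : cfg (l + 1) = Function.update (cfg l) i (pos (l + 1)) := by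
        simp [hcfg]
      -- admissibility of the next configuration
      have hadm' : LegInsertionData.IsAdmissible
          (⟨(Finset.univ.erase j).image (cfg (l + 1)), fun v ↦ ∑ b ∈ (Finset.univ.erase j).filter
            (fun b ↦ (cfg (l + 1)) b = v), L b, (cfg (l + 1)) j⟩ : LegInsertionData) V := by
        obtain ⟨hsl, hju⟩ := hstep l (by omega)
        cases hb : σ l
        · -- a jump
          obtain ⟨-, -, hyV, hyc, hlink⟩ := hju hb
          rw [hupd]
          refine tp_admissible_jump k L j V (cfg l) i (pos (l + 1)) G (hInjcfg l (by omega))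
            (hupd ▸ hInjcfg (l + 1) hl) hadml hyV hyc ?_ hG ?_
          · rw [hcfg_i]; exact hlink
          · rw [← hupd]; exact tp_sep_config hSepG (hSepcfg (l + 1) hl)
        · -- a slide
          obtain ⟨kk, τ, hτ, hpos, hxk, hyV, hyk, hyc⟩ := hsl hb
          have hupd' : cfg (l + 1) = Function.update (cfg l) i (cfg l i + τ) := by
            rw [hupd, hcfg_i, hpos]
          rw [hupd']
          refine s3_admissible_slide k L j V (cfg l) i τ kk G (hInjcfg l (by omega))
            (hupd' ▸ hInjcfg (l + 1) hl) hadml hτ ?_ ?_ ?_ ?_ hG ?_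
          · rw [hcfg_i]; exact hxk
          · rw [hcfg_i, ← hpos]; exact hyV
          · rw [hcfg_i, ← hpos]; exact hyk
          · rw [hcfg_i, ← hpos]; exact hyc
          · rw [← hupd']; exact tp_sep_config hSepG (hSepcfg (l + 1) hl)
      refine ⟨?_, hadm'⟩
      have hgood' : Good (cfg (l + 1)) :=
        ⟨hInjcfg (l + 1) hl, hadm', hFlcfg (l + 1) hl, hSepcfg (l + 1) hl⟩
      -- the last step as a one-step path
      obtain ⟨hsl, hju⟩ := hstep l (by omega)
      cases hb : σ l
      · obtain ⟨hFlR, hJ, -, -, -⟩ := hju hb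
        have hst : Step (cfg l) (cfg (l + 1)) false := by
          refine ⟨fun h => absurd h (by simp), fun _ => ⟨i, pos (l + 1), hupd, fun i'' h => ?_, ?_⟩⟩
          · rw [hcfg_o l i'' h]; exact hFlR i'' h
          · rw [hcfg_i]; exact hJ
        obtain ⟨q, σ', hq0, hqT, hqc, hqg, hqs⟩ :=
          tp_path_trans Good Step hpath (tp_path_jump Good Step hgood hgood' hst)
        refine ⟨q, σ', hq0, hqT, hqc.trans ?_, hqg, hqs⟩
        rw [Finset.range_add_one, Finset.filter_insert, if_pos hb,
          Finset.card_insert_of_notMem (by simp)]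
      · obtain ⟨kk, τ, hτ, hpos, -, -, -, -⟩ := hsl hb
        have hst : Step (cfg l) (cfg (l + 1)) true := by
          refine ⟨fun _ => ⟨i, τ, tp_unit_of_dir kk τ hτ, ?_⟩, fun h => absurd h (by simp)⟩
          rw [hupd, hcfg_i, hpos]
        obtain ⟨q, σ', hq0, hqT, hqc, hqg, hqs⟩ :=
          tp_path_trans Good Step hpath (tp_path_slide Good Step hgood hgood' hst)
        refine ⟨q, σ', hq0, hqT, hqc.trans ?_, hqg, hqs⟩
        rw [add_zero, Finset.range_add_one, Finset.filter_insert, if_neg (by simp [hb])]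
  obtain ⟨hpath, hadmL⟩ := key Lr le_rfl
  exact ⟨hpath, hadmL⟩

/-- **Registered sub-goal `s7_oneMover` of stub `stub_transportPaths`** (one mover, one-line form
of `tp_one_mover`). [folklore] -/
theorem s7_oneMover : ∀ (k : ℕ) (L : Fin k → ℕ) (j : Fin k) (V : Finset (ℤ × ℤ)) (G : ℕ) (Fl FlR : ℤ × ℤ → Prop) (Sep JumpOK : ℤ × ℤ → ℤ × ℤ → Prop), (∑ b ∈ Finset.univ.erase j, L b ≤ G) → (∀ u v, Sep u v → (G : ℤ) ≤ max |u.1 - v.1| |u.2 - v.2|) → (∀ u v, Sep u v → u ≠ v) → ∀ (P : Fin k → ℤ × ℤ) (i : Fin k) (pos : ℕ → ℤ × ℤ) (Lr : ℕ) (σ : ℕ → Bool), (pos 0 = P i) → (∀ i', i' ≠ i → Fl (P i')) → (∀ i₁ i₂, i₁ ≠ i → i₂ ≠ i → i₁ ≠ i₂ → Sep (P i₁) (P i₂)) → (∀ l, l ≤ Lr → Fl (pos l)) → (∀ l, l ≤ Lr → ∀ i', i' ≠ i → Sep (pos l) (P i') ∧ Sep (P i') (pos l)) → (∀ l, l < Lr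 → (σ l = true → ∃ (kk : Fin 4) (τ : ℤ × ℤ), (τ = Literature.Probability.LatticeModels.CollarLegModel.dir (kk + 1) ∨ τ = -Literature.Probability.LatticeModels.CollarLegModel.dir (kk + 1)) ∧ pos (l + 1) = pos l + τ ∧ pos l + Literature.Probability.LatticeModels.CollarLegModel.dir kk ∉ V ∧ pos (l + 1) ∈ V ∧ pos (l + 1) + Literature.Probability.LatticeModels.CollarLegModel.dir kk ∉ V ∧ ((Literature.Probability.LatticeModels.CollarLegModel.neighbours (pos (l + 1))).filter (fun z ↦ z ∉ V)).card = 1) ∧ (σ l = false → (∀ i', i' ≠ i → FlR (P i')) ∧ JumpOK (pos l) (pos (l + 1)) ∧ pos (l + 1) ∈ V ∧ ((Literature.Probability.LatticeModels.CollarLegModel.neighbours (pos (l + 1))).filter (fun z ↦ z ∉ V)).card = 1 ∧ ∃ (dx dy : Literature.Probability.LatticeModels.CollarLegModel.Dart) (g : ℕ), Literature.Probability.LatticeModels.CollarLegModel.outDart V (pos l) = some dx ∧ Literature.Probability.LatticeModels.CollarLegModel.outDart V (pos (l + 1)) = some dy ∧ ((Literature.Probability.LatticeModels.CollarLegModel.dsucc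 V)^[g] dx = dy ∨ (Literature.Probability.LatticeModels.CollarLegModel.dsucc V)^[g] dy = dx))) → (Literature.Probability.LatticeModels.CollarLegModel.LegInsertionData.IsAdmissible (⟨(Finset.univ.erase j).image P, fun v ↦ ∑ b ∈ (Finset.univ.erase j).filter (fun b ↦ P b = v), L b, P j⟩ : Literature.Probability.LatticeModels.CollarLegModel.LegInsertionData) V) → (∃ (q : ℕ → Fin k → ℤ × ℤ) (σ' : ℕ → Bool), q 0 = P ∧ q Lr = Function.update P i (pos Lr) ∧ ((Finset.range Lr).filter (fun t => σ' t = false)).card ≤ ((Finset.range Lr).filter (fun t => σ t = false)).card ∧ (∀ t, t ≤ Lr → (Function.Injective (q t) ∧ Literature.Probability.LatticeModels.CollarLegModel.LegInsertionData.IsAdmissible (⟨(Finset.univ.erase j).image (q t), fun v ↦ ∑ b ∈ (Finset.univ.erase j).filter (fun b ↦ (q t) b = v), L b, (q t) j⟩ : Literature.Probability.LatticeModels.CollarLegModel.LegInsertionData) V ∧ (∀ i, Fl (q t i)) ∧ (∀ i₁ i₂ : Fin k, i₁ ≠ i₂ → Sep (q t i₁) (q t i₂)))) ∧ (∀ t,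 t < Lr → (σ' t = true → ∃ (i : Fin k) (τ : ℤ × ℤ), (τ = (1, 0) ∨ τ = (-1, 0) ∨ τ = (0, 1) ∨ τ = (0, -1)) ∧ q (t + 1) = Function.update (q t) i (q t i + τ)) ∧ (σ' t = false → ∃ (i : Fin k) (q' : ℤ × ℤ), q (t + 1) = Function.update (q t) i q' ∧ (∀ i', i' ≠ i → FlR (q t i')) ∧ JumpOK (q t i) q'))) ∧ Literature.Probability.LatticeModels.CollarLegModel.LegInsertionData.IsAdmissible (⟨(Finset.univ.erase j).image (Function.update P i (pos Lr)), fun v ↦ ∑ b ∈ (Finset.univ.erase j).filter (fun b ↦ Function.update P i (pos Lr) b = v), L b, Function.update P i (pos Lr) j⟩ : Literature.Probability.LatticeModels.CollarLegModel.LegInsertionData) V :=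
  fun k L j V G Fl FlR Sep JumpOK hG hSepG hSepne P i pos Lr σ h0 hFlP hSepP hFlpos hSeppos hstep
      hadm =>
    tp_one_mover k L j V G Fl FlR Sep JumpOK hG hSepG hSepne P i pos Lr σ h0 hFlP hSepP hFlpos
      hSeppos hstep hadm

end Summit.CriticalPhenomena.CardyFormulaZ2.Cruxes.BoundaryDefectGaussianR.RainbowMonomialsInExcursionKernels

end
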